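import Literature.MathematicalPhysics.QuantumFieldTheory.Balaban1983to89.B6Prop25DecayTwoScaleV1

/-!
# `Balaban1983to89.B6Prop25L2LocTwoScaleV1` — T. Bałaban, *Propagators and renormalization transformations for lattice gauge theories. II*,
# Commun. Math. Phys. **96** (1984) 223–250 [Balaban1984PropagatorsII], PROPOSITION 2.5 p. 246, THE MEMBER `‖ζGJ‖` OF (1.114) FOR THE GENUINE
# TWO-SCALE `G = Δ_a⁻¹` OF (2.90), `Λ′ ⊂ T^{(j+1)}` ARBITRARY, for `tsV1` at the paper's scaling — file 11 of the two-level decay programme: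
# the BLOCK SCHUR TEST (row block bounds of `f` and of `f*` ⇒ localized `ℓ²` decay) and its first instance

statement-level skeleton of published theorems with citation tags; proofs where landed; nothing here is a claim about the Yang–Mills mass gap

PDF held: `paper:balaban1984-cmp96-propagators-rt-ii` (journal page = PDF page + 222), p. 246 [PDF 24]; `paper:balaban1984-cmp95-propagators-rt-i`
([4], journal page = PDF page + 16), p. 36 [PDF 20].  PRINT.  [B6] p. 246 (verbatim): *"Proposition 2.5. The operator G_□ defined by (2.90) on
the torus T_□ (or on the whole lattice ξZ^d) has the representation (2.129) and satisfies all the inequalities (1.110)–(1.114) of the Proposition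
1.2 with a positive constant δ₂ instead of δ₀. This constant depends on d and L only."*  [4] p. 36 (verbatim, as quoted in the tree's
`B5.Prop12Printed`): *"Finally there exists a constant O(1) such that ‖ζGJ‖, ‖ζ∇GJ‖, ‖ζG∇*J‖, ‖ζ∇G∇*J‖, ‖ζ∇∇GJ‖, ‖ζG∇*∇*J‖ ≤
O(1)e^{−δ₀|y−y′|}|ζ|‖J‖ (1.114) for supp ζ ⊂ Δ̃(y), supp J ⊂ Δ̃(y′)."*

CITATION HEADER (lean-in-tree rule) — WHAT IS REPRODUCED.  Phase-2 file of the `lit-balaban` typed skeleton (HOME `run/shared/lean/pub/lit-balaban/`),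
seat **p22 gen 15** (B6 fold owner r03, referee ref-4), FILE 11 of the PROP. 2.5 TWO-LEVEL DECAY programme (files 1–10: `…B6Repr2129Operator`
… `…B6Prop25GradDecayTwoScaleV1`, all landed; file 7 `…B6Prop25DecayTwoScaleV1.blockBound_G_scaling` = the uniform block row-sum bound of the
two-scale `G`); SKELETON row **B6.Prop2.5** (toolkit cell; decl of record untouched).

WHAT THIS FILE DOES.  §1 (abstract, statements and proofs OURS — the papers display nothing of it) THE BLOCK SCHUR TEST on the carriers of file 2
(`…B6BlockDecayCalculus`: finite index types `ι, κ` placed over a finite pseudo-metric space `(Y, ρ)` with lattice-sum profile `K`): if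
`f : ℓ²(κ) → ℓ²(ι)` has the block row-sum bound `(C_f, δ)` and its adjoint `f*` the block row-sum bound `(C_g, δ)` (i.e. `f` has block
COLUMN sums `(C_g, δ)`), then for `x` supported over the points within `r` of `y′`,
`Σ_{i : ρ(pι i, y) ≤ r} (f x)_i² ≤ C_f·C_g·(K(1)e^{(1+2δ)r})²·e^{−2δρ(y,y′)}·‖x‖²` (`sum_sq_apply_le_of_blockBounds`; the two ball sums
`rowSum_ball_le`, `colSum_ball_le` come from file 2's `abs_apply_le_of_support` tested on sign vectors, the `ℓ²` step is gen 13's signed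
Schur test `…B6SchurTorusBound.sum_sq_le_abs` for the kernel truncated to the two balls).  §2 THE TWO-SCALE `G` IS SELF-ADJOINT on `ℓ²` of the
fine bonds (`adjoint_G_V1`, from gen 8's `…B6SectCPositivity.G_symm`), so file 7's row block bound is also its column block bound
(`blockBound_Gadj_scaling`).  §3 **THE MEMBER `‖ζGJ‖` OF (1.114) FOR THE TWO-SCALE `G`** (`prop25_ineq114_0`, `prop25_ineq114_0_sqrt`): there are
`δ₂ > 0`, `C ≥ 0` depending on `d, L, a₀, a₁` only such that for every volume, `j + 1 ≤ m + K`, `Λ′`, weights `a₀n^{d+1} ≤ w ≤ a₁n^{d+1}`,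
radius `r ≥ 0`, every fine bond field `J` supported on the fine bonds over the unit sites within `r` of `y′`, and every real fine-lattice
function `ζ` supported over the unit sites within `r` of `y` with `|ζ| ≤ Z`:
`Σ_{b₀} (ζ(b₀₋)·(GJ)(b₀))² ≤ (C·e^{(1+2δ₂)r}·e^{−δ₂|y − y′|_T}·Z)²·‖J‖²`, i.e. `‖ζGJ‖ ≤ C e^{(1+2δ₂)r} e^{−δ₂|y−y′|_T}|ζ|‖J‖`.

HONEST SCOPE / DIVERGENCES. (1) Only the FIRST member `‖ζGJ‖` of (1.114) is treated here; `‖ζ∇GJ‖`, `‖ζG∇*J‖` need the block bound of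
`G∘∇_λ*` (the member `G∇*J` of (1.110), the next files of this programme) as the column bound of `∇_λG`; the members with two derivatives and
(1.111)–(1.113) are not treated. (2) `‖·‖` = the Euclidean norm on fine bond fields on both sides (the printed `L²(T_ξ)` norms carry the same
weight `ξ^{d}` on both sides, so the inequality is normalisation-free); `(ζA)(b₀) = ζ(b₀₋)A(b₀)` (cut-off read at the initial point of the
bond); the cubes `Δ̃(y)` are replaced by the unions of blocks within `r` of `y` (the printed cubes are the case `r = 1`), as in files 7, 10.
(3) `c = L^j`, weights in [4]'s window; `C, δ₂` depend on `d, L, a₀, a₁` only. (4) No new definition, no new hypothesis: files 2, 7 and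
`G_symm` BY NAME.  NOT summit progress.  Unit `lit-balaban-p22` (gen 15), 2026-08-22.
-/

noncomputable section

open scoped InnerProductSpace BigOperators
open Finset

namespace Literature.MathematicalPhysics.QuantumFieldTheory.Balaban1983to89.B6Prop25L2LocTwoScaleV1

open LatticeFieldCalculus B5SectBStatements B5Eq117TorusCarriers B6SectAOperatorsV1 B6SectCOperators
  B6SectCTwoScaleV1 B6SectCTwoScaleV1Lattice B5Eq118OneStroke
open BalabanImbrieJaffe1984to88.BIJ85AxialPropagator411 (BondSpace)
open B4Sect5Torus (IsPseudoDist SumBound)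
open B4TorusKernel.MultiPeriod (torusSupNorm torusSupNorm_nonneg)
open B4Sect5Proof (latticeConst latticeConst_nonneg)
open B6LowerBound2153Torus (rep)
open B5WalkCarrierTorus (normSq_eq)
open B6SchurTorusBound (apply_eq_sum_entry sum_sq_le_abs)
open B6BlockDecayCalculus (abs_apply_le_of_support adjoint_entry torusDist_isPseudoDist torusDist_sumBound)
open B6SectCPositivity (G_symm)
open B6Prop25DecayTwoScaleV1 (blockBound_G_scaling)

/-! ## §1  The block Schur test: row block bounds of `f` and of `f*` ⇒ localized `ℓ²` decay -/

section Abstract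

variable {Y : Type*} {ρ : Y → Y → ℝ} {KY : ℝ → ℝ}
variable {ι κ : Type} [Fintype ι] [DecidableEq ι] [Fintype κ] [DecidableEq κ]

omit [Fintype ι] [DecidableEq ι] in
/-- **row sums over a ball**: if `f` has the block bound `(C, δ)` (`C, δ ≥ 0`) then for every `i` whose position is within `r` of `y`,
`Σ_{k : ρ(pκ k, y′) ≤ r} |f(e_k)_i| ≤ C·K(1)e^{(1+2δ)r}·e^{−δρ(y,y′)}` — file 2's `abs_apply_le_of_support` tested on the sign vector of the
`i`-th row restricted to the ball. [cite: Balaban1984PropagatorsI, (1.114) p.36 (the cut-off `ℓ²` members; bookkeeping ours)] -/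
theorem rowSum_ball_le [Fintype Y] [DecidableEq Y] (hρ : IsPseudoDist ρ) (hK : SumBound ρ KY)
    (f : EuclideanSpace ℝ κ →ₗ[ℝ] EuclideanSpace ℝ ι) (pι : ι → Y) (pκ : κ → Y) {C δ r : ℝ} (hC : 0 ≤ C) (hδ : 0 ≤ δ)
    (hf : ∀ (i : ι) (y : Y), ∑ k ∈ univ.filter (fun k => pκ k = y), |f (EuclideanSpace.single k (1 : ℝ)) i| ≤ C * Real.exp (-(δ * ρ (pι i) y)))
    (y y' : Y) (i : ι) (hi : ρ (pι i) y ≤ r) :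
    ∑ k ∈ univ.filter (fun k => ρ (pκ k) y' ≤ r), |f (EuclideanSpace.single k (1 : ℝ)) i| ≤
      C * (KY 1 * Real.exp ((1 + 2 * δ) * r)) * Real.exp (-(δ * ρ y y')) := by
  classical
  -- the test vector: the signs of the `i`-th row on the ball, `0` elsewhere
  set x : EuclideanSpace ℝ κ := WithLp.toLp 2 (fun k => if ρ (pκ k) y' ≤ r then
    (if 0 ≤ f (EuclideanSpace.single k (1 : ℝ)) i then (1 : ℝ) else -1) else 0) with hxdef
  have hxk : ∀ k, x k = if ρ (pκ k) y' ≤ r then (if 0 ≤ f (EuclideanSpace.single k (1 : ℝ)) i then (1 : ℝ) else -1) else 0 :=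
    fun k => rfl
  have hsupp : ∀ k, x k ≠ 0 → ρ (pκ k) y' ≤ r := by
    intro k hk
    rw [hxk] at hk
    by_contra hk'
    exact hk (if_neg hk')
  have hX : ∀ k, |x k| ≤ 1 := fun k => by
    rw [hxk]; split_ifs <;> simp
  have hfx : f x i = ∑ k ∈ univ.filter (fun k => ρ (pκ k) y' ≤ r), |f (EuclideanSpace.single k (1 : ℝ)) i| := by
    rw [apply_eq_sum_entry, ← Finset.sum_filter_add_sum_filter_not univ (fun k => ρ (pκ k) y' ≤ r)]
    have hz : ∑ k ∈ univ.filter (fun k => ¬ ρ (pκ k) y' ≤ r), f (EuclideanSpace.single k (1 : ℝ)) i * x k = 0 :=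
      Finset.sum_eq_zero fun k hk => by rw [hxk, if_neg (Finset.mem_filter.mp hk).2, mul_zero]
    rw [hz, add_zero]
    refine Finset.sum_congr rfl fun k hk => ?_
    rw [hxk, if_pos (Finset.mem_filter.mp hk).2]
    split_ifs with hs
    · rw [mul_one, abs_of_nonneg hs]
    · rw [mul_neg, mul_one, abs_of_neg (lt_of_not_ge hs)]
  have key := abs_apply_le_of_support hρ hK f pι pκ hC hδ zero_le_one hf x y y' hsupp hX i hi
  rw [hfx, mul_one] at key
  exact le_trans (le_abs_self _) key

/-- **column sums over a ball**: if the adjoint `f*` has the block bound `(C, δ)` then for every `k` whose position is within `r` of `y′`,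
`Σ_{i : ρ(pι i, y) ≤ r} |f(e_k)_i| ≤ C·K(1)e^{(1+2δ)r}·e^{−δρ(y,y′)}` (`rowSum_ball_le` for `f*` and file 2's `adjoint_entry`).
[cite: Balaban1984PropagatorsI, (1.114) p.36 (the cut-off `ℓ²` members; bookkeeping ours)] -/
theorem colSum_ball_le [Fintype Y] [DecidableEq Y] (hρ : IsPseudoDist ρ) (hK : SumBound ρ KY)
    (f : EuclideanSpace ℝ κ →ₗ[ℝ] EuclideanSpace ℝ ι) (pι : ι → Y) (pκ : κ → Y) {C δ r : ℝ} (hC : 0 ≤ C) (hδ : 0 ≤ δ)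
    (hg : ∀ (k : κ) (y : Y), ∑ i ∈ univ.filter (fun i => pι i = y), |LinearMap.adjoint f (EuclideanSpace.single i (1 : ℝ)) k| ≤
      C * Real.exp (-(δ * ρ (pκ k) y)))
    (y y' : Y) (k : κ) (hk : ρ (pκ k) y' ≤ r) :
    ∑ i ∈ univ.filter (fun i => ρ (pι i) y ≤ r), |f (EuclideanSpace.single k (1 : ℝ)) i| ≤
      C * (KY 1 * Real.exp ((1 + 2 * δ) * r)) * Real.exp (-(δ * ρ y y')) := by
  have h := rowSum_ball_le hρ hK (LinearMap.adjoint f) pκ pι hC hδ hg y' y k hk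
  rw [hρ.symm y' y] at h
  refine le_trans (le_of_eq (Finset.sum_congr rfl fun i _ => ?_)) h
  rw [adjoint_entry]

/-- **THE BLOCK SCHUR TEST**: block row-sum bounds `(C_f, δ)` for `f` and `(C_g, δ)` for `f*` (`C_f, C_g, δ ≥ 0`) give, for every `x`
supported over the points within `r` of `y′`, the localized `ℓ²` bound with decay
`Σ_{i : ρ(pι i, y) ≤ r} (f x)_i² ≤ C_f·C_g·(K(1)e^{(1+2δ)r})²·e^{−2δρ(y,y′)}·Σ_k x_k²` — gen 13's signed Schur test
(`…B6SchurTorusBound.sum_sq_le_abs`) for the kernel `f(e_k)_i` truncated to the two balls, whose row sums are bounded by `rowSum_ball_le` and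
column sums by `colSum_ball_le`. [cite: Balaban1984PropagatorsI, (1.114) p.36 (the cut-off `ℓ²` members; statement and proof ours)] -/
theorem sum_sq_apply_le_of_blockBounds [Fintype Y] [DecidableEq Y] (hρ : IsPseudoDist ρ) (hK : SumBound ρ KY)
    (f : EuclideanSpace ℝ κ →ₗ[ℝ] EuclideanSpace ℝ ι) (pι : ι → Y) (pκ : κ → Y) {Cf Cg δ r : ℝ} (hCf : 0 ≤ Cf) (hCg : 0 ≤ Cg) (hδ : 0 ≤ δ)
    (hf : ∀ (i : ι) (y : Y), ∑ k ∈ univ.filter (fun k => pκ k = y), |f (EuclideanSpace.single k (1 : ℝ)) i| ≤ Cf * Real.exp (-(δ * ρ (pι i) y)))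
    (hg : ∀ (k : κ) (y : Y), ∑ i ∈ univ.filter (fun i => pι i = y), |LinearMap.adjoint f (EuclideanSpace.single i (1 : ℝ)) k| ≤
      Cg * Real.exp (-(δ * ρ (pκ k) y)))
    (x : EuclideanSpace ℝ κ) (y y' : Y) (hsupp : ∀ k, x k ≠ 0 → ρ (pκ k) y' ≤ r) :
    ∑ i ∈ univ.filter (fun i => ρ (pι i) y ≤ r), (f x i) ^ 2 ≤
      Cf * Cg * (KY 1 * Real.exp ((1 + 2 * δ) * r)) ^ 2 * Real.exp (-(2 * δ * ρ y y')) * ∑ k, (x k) ^ 2 := by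
  classical
  by_cases hne : (univ.filter fun i => ρ (pι i) y ≤ r).Nonempty
  swap
  · rw [Finset.not_nonempty_iff_eq_empty.mp hne, Finset.sum_empty]
    exact mul_nonneg (mul_nonneg (mul_nonneg (mul_nonneg hCf hCg) (sq_nonneg _)) (Real.exp_pos _).le)
      (Finset.sum_nonneg fun _ _ => sq_nonneg _)
  obtain ⟨i₀, hi₀⟩ := hne
  have hK1 : 0 ≤ KY 1 := le_trans (Finset.sum_nonneg fun _ _ => (Real.exp_pos _).le) (hK 1 one_pos (pι i₀))
  -- the truncated kernel and its Schur data
  set T : ι → κ → ℝ := fun i k =>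
    if ρ (pι i) y ≤ r ∧ ρ (pκ k) y' ≤ r then f (EuclideanSpace.single k (1 : ℝ)) i else 0 with hT
  set A : ℝ := Cf * (KY 1 * Real.exp ((1 + 2 * δ) * r)) * Real.exp (-(δ * ρ y y')) with hA
  set B : ℝ := Cg * (KY 1 * Real.exp ((1 + 2 * δ) * r)) * Real.exp (-(δ * ρ y y')) with hB
  have hA0 : 0 ≤ A := by positivity
  have hB0 : 0 ≤ B := by positivity
  have hrow : ∀ i, ∑ k, |T i k| ≤ A := by
    intro i
    by_cases hi : ρ (pι i) y ≤ r
    · have e : ∑ k, |T i k| = ∑ k ∈ univ.filter (fun k => ρ (pκ k) y' ≤ r), |f (EuclideanSpace.single k (1 : ℝ)) i| := by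
        rw [← Finset.sum_filter_add_sum_filter_not univ (fun k => ρ (pκ k) y' ≤ r)]
        have hz : ∑ k ∈ univ.filter (fun k => ¬ ρ (pκ k) y' ≤ r), |T i k| = 0 :=
          Finset.sum_eq_zero fun k hk => by
            simp only [hT, if_neg (not_and_of_not_right _ (Finset.mem_filter.mp hk).2), abs_zero]
        rw [hz, add_zero]
        refine Finset.sum_congr rfl fun k hk => ?_
        simp only [hT, if_pos (And.intro hi (Finset.mem_filter.mp hk).2)]
      rw [e]
      exact rowSum_ball_le hρ hK f pι pκ hCf hδ hf y y' i hi
    · have e : ∑ k, |T i k| = 0 := Finset.sum_eq_zero fun k _ => by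
        simp only [hT, if_neg (not_and_of_not_left _ hi), abs_zero]
      rw [e]; exact hA0
  have hcol : ∀ k, ∑ i, |T i k| ≤ B := by
    intro k
    by_cases hk : ρ (pκ k) y' ≤ r
    · have e : ∑ i, |T i k| = ∑ i ∈ univ.filter (fun i => ρ (pι i) y ≤ r), |f (EuclideanSpace.single k (1 : ℝ)) i| := by
        rw [← Finset.sum_filter_add_sum_filter_not univ (fun i => ρ (pι i) y ≤ r)]
        have hz : ∑ i ∈ univ.filter (fun i => ¬ ρ (pι i) y ≤ r), |T i k| = 0 :=
          Finset.sum_eq_zero fun i hi => by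
            simp only [hT, if_neg (not_and_of_not_left _ (Finset.mem_filter.mp hi).2), abs_zero]
        rw [hz, add_zero]
        refine Finset.sum_congr rfl fun i hi => ?_
        simp only [hT, if_pos (And.intro (Finset.mem_filter.mp hi).2 hk)]
      rw [e]
      exact colSum_ball_le hρ hK f pι pκ hCg hδ hg y y' k hk
    · have e : ∑ i, |T i k| = 0 := Finset.sum_eq_zero fun i _ => by
        simp only [hT, if_neg (not_and_of_not_right _ hk), abs_zero]
      rw [e]; exact hB0
  -- the truncated kernel acts on `x` as `f` does, on the ball of `y`
  have hTx : ∀ i, ∑ k, T i k * x k = if ρ (pι i) y ≤ r then f x i else 0 := by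
    intro i
    by_cases hi : ρ (pι i) y ≤ r
    · rw [if_pos hi, apply_eq_sum_entry]
      refine Finset.sum_congr rfl fun k _ => ?_
      by_cases hk : ρ (pκ k) y' ≤ r
      · simp only [hT, if_pos (And.intro hi hk)]
      · have hx0 : x k = 0 := by
          by_contra h
          exact hk (hsupp k h)
        rw [hx0, mul_zero, mul_zero]
    · rw [if_neg hi]
      exact Finset.sum_eq_zero fun k _ => by simp only [hT, if_neg (not_and_of_not_left _ hi), zero_mul]
  have hlhs : ∑ i ∈ univ.filter (fun i => ρ (pι i) y ≤ r), (f x i) ^ 2 = ∑ i, (∑ k, T i k * x k) ^ 2 := by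
    rw [← Finset.sum_filter_add_sum_filter_not univ (fun i => ρ (pι i) y ≤ r) (fun i => (∑ k, T i k * x k) ^ 2)]
    have hz : ∑ i ∈ univ.filter (fun i => ¬ ρ (pι i) y ≤ r), (∑ k, T i k * x k) ^ 2 = 0 :=
      Finset.sum_eq_zero fun i hi => by
        rw [hTx i, if_neg (Finset.mem_filter.mp hi).2]; ring
    rw [hz, add_zero]
    refine Finset.sum_congr rfl fun i hi => ?_
    rw [hTx i, if_pos (Finset.mem_filter.mp hi).2]
  have hS := sum_sq_le_abs T (fun k => x k) hA0 hrow hcol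
  rw [hlhs]
  refine hS.trans (le_of_eq ?_)
  have hAB : A * B = Cf * Cg * (KY 1 * Real.exp ((1 + 2 * δ) * r)) ^ 2 * Real.exp (-(2 * δ * ρ y y')) := by
    have h2 : Real.exp (-(2 * δ * ρ y y')) = Real.exp (-(δ * ρ y y')) * Real.exp (-(δ * ρ y y')) := by
      rw [← Real.exp_add]; ring_nf
    rw [hA, hB, h2]; ring
  rw [hAB]

end Abstract

/-! ## §2  The two-scale `G` is self-adjoint; its column block bound -/

section Adjoint

variable {d L m K : ℕ} {hd : 1 ≤ d + 1} {hL : Odd L ∧ 1 < L} {c : ℝ} (hc : c ≠ 0) {j : ℕ}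
  (hj : j + 1 ≤ (⟨d + 1, L, m, K, hd, hL⟩ : Params).m + (⟨d + 1, L, m, K, hd, hL⟩ : Params).K)
  (Λ' : Finset (Site (⟨d + 1, L, m, K, hd, hL⟩ : Params) (j + 1))) {w : CIdx j Λ' → ℝ} (hw : ∀ i, 0 < w i)

include hj hw in
/-- **`G* = G`**: the two-scale `G = Δ_a⁻¹` of (2.90) for `tsV1` is self-adjoint on `ℓ²` of the fine bonds (gen 8's `G_symm`: *"The operator
G is positive"*, p. 228, for the lattice data of `tsV1`). [cite: Balaban1984PropagatorsII, (2.90) p.239, p.228] -/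
theorem adjoint_G_V1 : LinearMap.adjoint (tsV1 hc Λ' w).G = (tsV1 hc Λ' w).G :=
  ((LinearMap.eq_adjoint_iff _ _).mpr fun x y =>
    G_symm (isLattice Λ' hc hj hw) (positive Λ' hc hj w) x y).symm

end Adjoint

open Classical in
/-- **the COLUMN block bound of the two-scale `G`** (at `c = L^j`, weights in the window): the block row-sum bound of file 7 holds verbatim
for `G*` (= `G`, `adjoint_G_V1`). [cite: Balaban1984PropagatorsII, Prop. 2.5 p.246] -/
theorem blockBound_Gadj_scaling (d L : ℕ) (hd : 1 ≤ d + 1) (hL : Odd L ∧ 1 < L) {a₀ a₁ : ℝ} (ha₀ : 0 < a₀) (ha₁ : a₀ ≤ a₁) :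
    ∃ δ : ℝ, 0 < δ ∧ ∃ C : ℝ, 0 ≤ C ∧ ∀ (m K : ℕ) (j : ℕ) (hc : ((L : ℝ) ^ j) ≠ 0)
      (_hj : j + 1 ≤ (⟨d + 1, L, m, K, hd, hL⟩ : Params).m + (⟨d + 1, L, m, K, hd, hL⟩ : Params).K)
      (Λ' : Finset (Site (⟨d + 1, L, m, K, hd, hL⟩ : Params) (j + 1))) (w : CIdx j Λ' → ℝ)
      (_hw0 : ∀ i, a₀ * ((L : ℝ) ^ j) ^ (d + 1) ≤ w i) (_hw1 : ∀ i, w i ≤ a₁ * ((L : ℝ) ^ j) ^ (d + 1)),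
      (∀ (b₀ : PBond (⟨d + 1, L, m, K, hd, hL⟩ : Params) 0) (y : Site (⟨d + 1, L, m, K, hd, hL⟩ : Params) j),
        ∑ b₀' ∈ univ.filter (fun b₀' : PBond (⟨d + 1, L, m, K, hd, hL⟩ : Params) 0 => iterBlockOf j b₀'.src = y),
            |(tsV1 hc Λ' w).G (EuclideanSpace.single b₀' (1 : ℝ)) b₀| ≤
          C * Real.exp (-(δ * torusSupNorm (Mk (⟨d + 1, L, m, K, hd, hL⟩ : Params) j)
            (rep (Mk (⟨d + 1, L, m, K, hd, hL⟩ : Params) j) (iterBlockOf j b₀.src) - rep (Mk (⟨d + 1, L, m, K, hd, hL⟩ : Params) j) y)))) ∧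
      (∀ (b₀ : PBond (⟨d + 1, L, m, K, hd, hL⟩ : Params) 0) (y : Site (⟨d + 1, L, m, K, hd, hL⟩ : Params) j),
        ∑ b₀' ∈ univ.filter (fun b₀' : PBond (⟨d + 1, L, m, K, hd, hL⟩ : Params) 0 => iterBlockOf j b₀'.src = y),
            |LinearMap.adjoint (tsV1 hc Λ' w).G (EuclideanSpace.single b₀' (1 : ℝ)) b₀| ≤
          C * Real.exp (-(δ * torusSupNorm (Mk (⟨d + 1, L, m, K, hd, hL⟩ : Params) j)
            (rep (Mk (⟨d + 1, L, m, K, hd, hL⟩ : Params) j) (iterBlockOf j b₀.src) - rep (Mk (⟨d + 1, L, m, K, hd, hL⟩ : Params) j) y)))) := by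
  obtain ⟨δ, hδ, C, hC, h⟩ := blockBound_G_scaling d L hd hL ha₀ ha₁
  refine ⟨δ, hδ, C, hC, fun m K j hc hj Λ' w hw0 hw1 => ⟨h m K j hc hj Λ' w hw0 hw1, fun b₀ y => ?_⟩⟩
  have hw : ∀ i, 0 < w i := fun i => lt_of_lt_of_le (by positivity) (hw0 i)
  rw [adjoint_G_V1 hc hj Λ' hw]
  exact h m K j hc hj Λ' w hw0 hw1 b₀ y

/-! ## §3  The member `‖ζGJ‖` of (1.114) for the two-scale `G` -/

open Classical in
/-- **PROPOSITION 2.5, THE MEMBER `‖ζGJ‖` OF (1.114)** for the genuine two-scale `G` of (2.90), `Λ′` arbitrary (at `c = L^j`, weights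
`a₀n^{d+1} ≤ w ≤ a₁n^{d+1}`): there are `δ₂ > 0`, `C ≥ 0` depending on `d, L, a₀, a₁` only such that for every volume, `j + 1 ≤ m + K`, `Λ′`,
weights in the window, radius `r ≥ 0`, every fine bond field `J` supported on the fine bonds over the unit sites within `r` of `y′`, and every
real fine-lattice function `ζ` supported over the unit sites within `r` of `y` with `|ζ| ≤ Z`:
`Σ_{b₀} (ζ(b₀₋)(GJ)(b₀))² ≤ (C·e^{(1+2δ₂)r}·e^{−δ₂|y − y′|_T}·Z)²·‖J‖²` — the block Schur test of §1 with the row (file 7) and column (§2) block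
bounds of `G`. [cite: Balaban1984PropagatorsII, Prop. 2.5 p.246; Balaban1984PropagatorsI, (1.114) p.36] -/
theorem prop25_ineq114_0 (d L : ℕ) (hd : 1 ≤ d + 1) (hL : Odd L ∧ 1 < L) {a₀ a₁ : ℝ} (ha₀ : 0 < a₀) (ha₁ : a₀ ≤ a₁) :
    ∃ δ : ℝ, 0 < δ ∧ ∃ C : ℝ, 0 ≤ C ∧ ∀ (m K : ℕ) (j : ℕ) (hc : ((L : ℝ) ^ j) ≠ 0)
      (_hj : j + 1 ≤ (⟨d + 1, L, m, K, hd, hL⟩ : Params).m + (⟨d + 1, L, m, K, hd, hL⟩ : Params).K)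
      (Λ' : Finset (Site (⟨d + 1, L, m, K, hd, hL⟩ : Params) (j + 1))) (w : CIdx j Λ' → ℝ)
      (_hw0 : ∀ i, a₀ * ((L : ℝ) ^ j) ^ (d + 1) ≤ w i) (_hw1 : ∀ i, w i ≤ a₁ * ((L : ℝ) ^ j) ^ (d + 1))
      (r : ℝ) (_hr : 0 ≤ r) (J : BondSpace (⟨d + 1, L, m, K, hd, hL⟩ : Params))
      (ζ : Site (⟨d + 1, L, m, K, hd, hL⟩ : Params) 0 → ℝ) (Z : ℝ) (_hZ : 0 ≤ Z)
      (y y' : Site (⟨d + 1, L, m, K, hd, hL⟩ : Params) j)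
      (_hsuppJ : ∀ b : PBond (⟨d + 1, L, m, K, hd, hL⟩ : Params) 0, J b ≠ 0 →
        torusSupNorm (Mk (⟨d + 1, L, m, K, hd, hL⟩ : Params) j)
          (rep (Mk (⟨d + 1, L, m, K, hd, hL⟩ : Params) j) (iterBlockOf j b.src) - rep (Mk (⟨d + 1, L, m, K, hd, hL⟩ : Params) j) y') ≤ r)
      (_hsuppζ : ∀ x : Site (⟨d + 1, L, m, K, hd, hL⟩ : Params) 0, ζ x ≠ 0 →
        torusSupNorm (Mk (⟨d + 1, L, m, K, hd, hL⟩ : Params) j)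
          (rep (Mk (⟨d + 1, L, m, K, hd, hL⟩ : Params) j) (iterBlockOf j x) - rep (Mk (⟨d + 1, L, m, K, hd, hL⟩ : Params) j) y) ≤ r)
      (_hζ : ∀ x : Site (⟨d + 1, L, m, K, hd, hL⟩ : Params) 0, |ζ x| ≤ Z),
      ∑ b₀ : PBond (⟨d + 1, L, m, K, hd, hL⟩ : Params) 0, (ζ b₀.src * (tsV1 hc Λ' w).G J b₀) ^ 2 ≤
        (C * Real.exp ((1 + 2 * δ) * r) * Real.exp (-(δ * torusSupNorm (Mk (⟨d + 1, L, m, K, hd, hL⟩ : Params) j)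
          (rep (Mk (⟨d + 1, L, m, K, hd, hL⟩ : Params) j) y - rep (Mk (⟨d + 1, L, m, K, hd, hL⟩ : Params) j) y'))) * Z) ^ 2 * ‖J‖ ^ 2 := by
  obtain ⟨δ, hδ, C, hC, h⟩ := blockBound_Gadj_scaling d L hd hL ha₀ ha₁
  refine ⟨δ, hδ, C * latticeConst (d + 1) 1, mul_nonneg hC (latticeConst_nonneg _ zero_le_one), ?_⟩
  intro m K j hc hj Λ' w hw0 hw1 r hr J ζ Z hZ y y' hsuppJ hsuppζ hζ
  obtain ⟨hf, hg⟩ := h m K j hc hj Λ' w hw0 hw1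
  have hρ : IsPseudoDist (fun t t' : Site (⟨d + 1, L, m, K, hd, hL⟩ : Params) j => torusSupNorm (Mk (⟨d + 1, L, m, K, hd, hL⟩ : Params) j)
      (rep (Mk (⟨d + 1, L, m, K, hd, hL⟩ : Params) j) t - rep (Mk (⟨d + 1, L, m, K, hd, hL⟩ : Params) j) t')) :=
    torusDist_isPseudoDist (Mk (⟨d + 1, L, m, K, hd, hL⟩ : Params) j)
  have hK : SumBound (fun t t' : Site (⟨d + 1, L, m, K, hd, hL⟩ : Params) j => torusSupNorm (Mk (⟨d + 1, L, m, K, hd, hL⟩ : Params) j)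
      (rep (Mk (⟨d + 1, L, m, K, hd, hL⟩ : Params) j) t - rep (Mk (⟨d + 1, L, m, K, hd, hL⟩ : Params) j) t')) (fun a => latticeConst (d + 1) a) :=
    torusDist_sumBound (Mk (⟨d + 1, L, m, K, hd, hL⟩ : Params) j)
  have hS := sum_sq_apply_le_of_blockBounds hρ hK (tsV1 hc Λ' w).G
    (fun b₀ : PBond (⟨d + 1, L, m, K, hd, hL⟩ : Params) 0 => iterBlockOf j b₀.src)
    (fun b₀ : PBond (⟨d + 1, L, m, K, hd, hL⟩ : Params) 0 => iterBlockOf j b₀.src) hC hC hδ.le hf hg J y y' hsuppJ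
  -- `ζ` vanishes off the ball of `y` and is bounded by `Z` on it
  have hζ2 : ∀ b₀ : PBond (⟨d + 1, L, m, K, hd, hL⟩ : Params) 0, (ζ b₀.src * (tsV1 hc Λ' w).G J b₀) ^ 2 ≤
      (if torusSupNorm (Mk (⟨d + 1, L, m, K, hd, hL⟩ : Params) j)
          (rep (Mk (⟨d + 1, L, m, K, hd, hL⟩ : Params) j) (iterBlockOf j b₀.src) - rep (Mk (⟨d + 1, L, m, K, hd, hL⟩ : Params) j) y) ≤ r
        then Z ^ 2 * ((tsV1 hc Λ' w).G J b₀) ^ 2 else 0) := by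
    intro b₀
    split_ifs with hb
    · rw [mul_pow]
      have hz2 : (ζ b₀.src) ^ 2 ≤ Z ^ 2 := by
        rw [← sq_abs (ζ b₀.src)]
        exact pow_le_pow_left₀ (abs_nonneg _) (hζ b₀.src) 2
      exact mul_le_mul_of_nonneg_right hz2 (sq_nonneg _)
    · have hz : ζ b₀.src = 0 := by
        by_contra hne
        exact hb (hsuppζ b₀.src hne)
      rw [hz, zero_mul]; ring_nf; rfl
  have h1 : ∑ b₀ : PBond (⟨d + 1, L, m, K, hd, hL⟩ : Params) 0, (ζ b₀.src * (tsV1 hc Λ' w).G J b₀) ^ 2 ≤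
      Z ^ 2 * ∑ b₀ ∈ univ.filter (fun b₀ : PBond (⟨d + 1, L, m, K, hd, hL⟩ : Params) 0 =>
        torusSupNorm (Mk (⟨d + 1, L, m, K, hd, hL⟩ : Params) j)
          (rep (Mk (⟨d + 1, L, m, K, hd, hL⟩ : Params) j) (iterBlockOf j b₀.src) - rep (Mk (⟨d + 1, L, m, K, hd, hL⟩ : Params) j) y) ≤ r),
        ((tsV1 hc Λ' w).G J b₀) ^ 2 := by
    refine (Finset.sum_le_sum fun b₀ _ => hζ2 b₀).trans (le_of_eq ?_)
    rw [Finset.sum_ite, Finset.sum_const_zero, add_zero, Finset.mul_sum]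
  have hJ2 : ∑ b₀ : PBond (⟨d + 1, L, m, K, hd, hL⟩ : Params) 0, (J b₀) ^ 2 = ‖J‖ ^ 2 := (normSq_eq J).symm
  rw [hJ2] at hS
  refine h1.trans ((mul_le_mul_of_nonneg_left hS (sq_nonneg Z)).trans (le_of_eq ?_))
  have h2 : Real.exp (-(2 * δ * torusSupNorm (Mk (⟨d + 1, L, m, K, hd, hL⟩ : Params) j)
      (rep (Mk (⟨d + 1, L, m, K, hd, hL⟩ : Params) j) y - rep (Mk (⟨d + 1, L, m, K, hd, hL⟩ : Params) j) y'))) =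
      Real.exp (-(δ * torusSupNorm (Mk (⟨d + 1, L, m, K, hd, hL⟩ : Params) j)
      (rep (Mk (⟨d + 1, L, m, K, hd, hL⟩ : Params) j) y - rep (Mk (⟨d + 1, L, m, K, hd, hL⟩ : Params) j) y'))) ^ 2 := by
    rw [sq, ← Real.exp_add]; ring_nf
  rw [h2]; ring

open Classical in
/-- **(1.114), THE MEMBER `‖ζGJ‖`, IN THE PRINTED SHAPE** `‖ζGJ‖ ≤ O(1)e^{−δ₂|y−y′|}|ζ|‖J‖`: the square root of `prop25_ineq114_0`.
[cite: Balaban1984PropagatorsII, Prop. 2.5 p.246; Balaban1984PropagatorsI, (1.114) p.36] -/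
theorem prop25_ineq114_0_sqrt (d L : ℕ) (hd : 1 ≤ d + 1) (hL : Odd L ∧ 1 < L) {a₀ a₁ : ℝ} (ha₀ : 0 < a₀) (ha₁ : a₀ ≤ a₁) :
    ∃ δ : ℝ, 0 < δ ∧ ∃ C : ℝ, 0 ≤ C ∧ ∀ (m K : ℕ) (j : ℕ) (hc : ((L : ℝ) ^ j) ≠ 0)
      (_hj : j + 1 ≤ (⟨d + 1, L, m, K, hd, hL⟩ : Params).m + (⟨d + 1, L, m, K, hd, hL⟩ : Params).K)
      (Λ' : Finset (Site (⟨d + 1, L, m, K, hd, hL⟩ : Params) (j + 1))) (w : CIdx j Λ' → ℝ)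
      (_hw0 : ∀ i, a₀ * ((L : ℝ) ^ j) ^ (d + 1) ≤ w i) (_hw1 : ∀ i, w i ≤ a₁ * ((L : ℝ) ^ j) ^ (d + 1))
      (r : ℝ) (_hr : 0 ≤ r) (J : BondSpace (⟨d + 1, L, m, K, hd, hL⟩ : Params))
      (ζ : Site (⟨d + 1, L, m, K, hd, hL⟩ : Params) 0 → ℝ) (Z : ℝ) (_hZ : 0 ≤ Z)
      (y y' : Site (⟨d + 1, L, m, K, hd, hL⟩ : Params) j)
      (_hsuppJ : ∀ b : PBond (⟨d + 1, L, m, K, hd, hL⟩ : Params) 0, J b ≠ 0 →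
        torusSupNorm (Mk (⟨d + 1, L, m, K, hd, hL⟩ : Params) j)
          (rep (Mk (⟨d + 1, L, m, K, hd, hL⟩ : Params) j) (iterBlockOf j b.src) - rep (Mk (⟨d + 1, L, m, K, hd, hL⟩ : Params) j) y') ≤ r)
      (_hsuppζ : ∀ x : Site (⟨d + 1, L, m, K, hd, hL⟩ : Params) 0, ζ x ≠ 0 →
        torusSupNorm (Mk (⟨d + 1, L, m, K, hd, hL⟩ : Params) j)
          (rep (Mk (⟨d + 1, L, m, K, hd, hL⟩ : Params) j) (iterBlockOf j x) - rep (Mk (⟨d + 1, L, m, K, hd, hL⟩ : Params) j) y) ≤ r)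
      (_hζ : ∀ x : Site (⟨d + 1, L, m, K, hd, hL⟩ : Params) 0, |ζ x| ≤ Z),
      Real.sqrt (∑ b₀ : PBond (⟨d + 1, L, m, K, hd, hL⟩ : Params) 0, (ζ b₀.src * (tsV1 hc Λ' w).G J b₀) ^ 2) ≤
        C * Real.exp ((1 + 2 * δ) * r) * Real.exp (-(δ * torusSupNorm (Mk (⟨d + 1, L, m, K, hd, hL⟩ : Params) j)
          (rep (Mk (⟨d + 1, L, m, K, hd, hL⟩ : Params) j) y - rep (Mk (⟨d + 1, L, m, K, hd, hL⟩ : Params) j) y'))) * Z * ‖J‖ := by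
  obtain ⟨δ, hδ, C, hC, h⟩ := prop25_ineq114_0 d L hd hL ha₀ ha₁
  refine ⟨δ, hδ, C, hC, ?_⟩
  intro m K j hc hj Λ' w hw0 hw1 r hr J ζ Z hZ y y' hsuppJ hsuppζ hζ
  have h1 := h m K j hc hj Λ' w hw0 hw1 r hr J ζ Z hZ y y' hsuppJ hsuppζ hζ
  have h0 : 0 ≤ C * Real.exp ((1 + 2 * δ) * r) * Real.exp (-(δ * torusSupNorm (Mk (⟨d + 1, L, m, K, hd, hL⟩ : Params) j)
          (rep (Mk (⟨d + 1, L, m, K, hd, hL⟩ : Params) j) y - rep (Mk (⟨d + 1, L, m, K, hd, hL⟩ : Params) j) y'))) * Z * ‖J‖ := by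
    positivity
  refine (Real.sqrt_le_sqrt h1).trans (le_of_eq ?_)
  rw [← mul_pow, Real.sqrt_sq h0]

end Literature.MathematicalPhysics.QuantumFieldTheory.Balaban1983to89.B6Prop25L2LocTwoScaleV1

end
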